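import Summits.ABC.StewartYu.PadicG3ParVC
import HarnessLib

/-!
# The `p`-adic Gen-3 parameter record v2 (corrected family `…V`) — part VD: the master budget inequalities

Support file (three closed forms + plain theorems; no named facts). Continues `PadicG3ParVC`. Twin of
`PadicG3ParE`/`ParF` for the R1′ family in the unit `Zp = G·(g·XV·LgV)` (`zerosV s ν ≥ 8·2^ν·Zp`), for the
m = 0 branch of the D-m0 ruling (plan g8 2026-08-27T03:23:27Z: v2 serves `m = 0`, v1 serves `m ≥ 1`); the
hypotheses `½ ≤ θ₀` and `N_q ≤ 2ⁿK` make every `X`-free logarithm `O(G)` (`yloadG ≤ 11 G`):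
* **(B3′) `kstep_budgetV`**: `AYV + logKV ν + ADV E + 1 ≤ zerosV s ν` (every level, every stage, any rescaling
  exponent `0 ≤ E ≤ W_LV`);
* **(B4′) `halfstep_budgetV`**: `AYV + 2ⁿ·(logKV 0 + ADV E + 1) ≤ zerosV s n`;
* the U-branch conditioning allowance `AcondV` and the floor-phase range term `CondFloorV` are DEFINED here;
  their bound and **(C0′) `order_budgetV`** are in `PadicG3ParVE`.

## References
* [Nesterenko2003] Yu. V. Nesterenko, LNM 1819 (2003) — §4.2 (4.29)–(4.35), §4.3 (4.39)–(4.45).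
* [Yu2013] K. Yu, Acta Math. 211 (2013) — §3.1, (5.13)–(5.16).
-/

noncomputable section

open Finset Real

namespace Summit.ABC.StewartYu

namespace PadicG3Par

variable {n : ℕ} (P : PadicG3Par n)

/-! ### The remaining allowances -/

/-- rescaling allowance `ADV E = MordV₀₀ · E` (the factor `2^{(ŜG−s)t₀}`-type, `E ≤ W_LV`). [cite: Nesterenko2003, (4.26)] -/
def ADV (E : ℝ) : ℝ := P.MordV 0 0 * E

/-- U-branch conditioning allowance at `(s, ν)`:
`(2^{ν+1}XsV s + 1)(TV s + 1)·(log p/(p−1)) + (TV s + 1)·log(2(2^{ν+1} XsV s + 1)) + 4 LgV log p`.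
[cite: Nesterenko2003, (4.30)] -/
def AcondV (s ν : ℕ) : ℝ :=
  (2 ^ (ν + 1) * P.XsV s + 1) * (P.TV s + 1) * (Real.log P.p / (P.p - 1)) +
    (P.TV s + 1) * Real.log (2 * (2 ^ (ν + 1) * P.XsV s + 1)) + 4 * P.LgV * Real.log P.p

/-- the floor-phase range term `CondFloorV ν = 2^{ν+1} · 2^{ŜG} · g · XV · (log p/(p−1))`. [folklore] -/
def CondFloorV (ν : ℕ) : ℝ := 2 ^ (ν + 1) * 2 ^ P.SdG * P.g * P.XV * (Real.log P.p / (P.p - 1))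

/-! ### Small terms -/

/-- `G ≤ Zp/2^32`, `HV ≤ Zp/2^32`, `LgV ≤ Zp/2048`, `G·LgV ≤ Zp/128`, `XV·LgV ≤ Zp/16`. [folklore] -/
theorem tinyV : P.G ≤ P.Zp / 2 ^ 32 ∧ (P.HV : ℝ) ≤ P.Zp / 2 ^ 32 ∧ (P.LgV : ℝ) ≤ P.Zp / 2048 ∧
    P.G * P.LgV ≤ P.Zp / 128 ∧ (P.XV : ℝ) * P.LgV ≤ P.Zp / 16 := by
  have hG := P.sixteen_le_G
  have hg := P.one_le_g
  have hX := P.XV_ge_128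
  have hL : (2 : ℝ) ^ 25 ≤ P.LgV := by
    have h1 : 2 ^ 25 ≤ 2 ^ (n + 25) := Nat.pow_le_pow_right (by norm_num) (by omega)
    exact_mod_cast h1.trans P.two_pow_le_LgV
  have hH := P.HV_le
  have hn : (1 : ℝ) ≤ n := by exact_mod_cast P.hn
  have hG0 : (0 : ℝ) ≤ P.G := by linarith
  have hX0 : (0 : ℝ) ≤ P.XV := by linarith
  have hL0 : (0 : ℝ) ≤ P.LgV := by linarith
  have hg0 : (0 : ℝ) ≤ P.g := by linarith
  have hgXL : (128 : ℝ) * 2 ^ 25 ≤ P.g * P.XV * P.LgV := by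
    have h1 : (128 : ℝ) * 2 ^ 25 ≤ P.XV * P.LgV := mul_le_mul hX hL (by positivity) hX0
    nlinarith [mul_nonneg hX0 hL0]
  have hgX : (128 : ℝ) ≤ P.g * P.XV := by nlinarith
  have hgL : (2 : ℝ) ^ 25 ≤ P.g * P.LgV := by nlinarith
  unfold Zp
  refine ⟨?_, ?_, ?_, ?_, ?_⟩
  · rw [le_div_iff₀ (by positivity)]
    have : (2 : ℝ) ^ 32 = 128 * 2 ^ 25 := by norm_num
    nlinarith
  · rw [le_div_iff₀ (by positivity)]
    have hH' : (P.HV : ℝ) ≤ P.G * P.XV / 128 := by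
      calc (P.HV : ℝ) ≤ P.G * P.XV / (64 * (n + 1)) := hH
        _ ≤ P.G * P.XV / 128 := div_le_div_of_nonneg_left (by positivity) (by norm_num) (by linarith)
    have : (2 : ℝ) ^ 32 = 128 * 2 ^ 25 := by norm_num
    have e : P.G * (P.g * P.XV * P.LgV) = (P.G * P.XV) * (P.g * P.LgV) := by ring
    rw [this, e]
    have h0 : 0 ≤ P.G * P.XV := by positivity
    nlinarith [mul_le_mul hH' hgL (by positivity) (by positivity)]
  · rw [le_div_iff₀ (by positivity)]
    nlinarith [mul_le_mul hG hgX (by positivity) hG0]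
  · rw [le_div_iff₀ (by positivity)]
    have h0 : 0 ≤ P.G * P.LgV := by positivity
    nlinarith [mul_le_mul_of_nonneg_left hgX h0]
  · rw [le_div_iff₀ (by positivity)]
    have h0 : (0 : ℝ) ≤ P.XV * P.LgV := by positivity
    have : (16 : ℝ) ≤ P.G * P.g := by nlinarith
    nlinarith [mul_le_mul_of_nonneg_left this h0]

/-- negligible terms: `2·yloadG + G + 2 HV + 8 ≤ Zp/100` (under `½ ≤ θ₀`, `N_q ≤ 2ⁿ K`). [folklore] -/
theorem smallV_le (hθ : 1 / 2 ≤ P.θ₀) (hNqK : P.Nq ≤ 2 ^ n * P.K) :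
    2 * P.yloadG + P.G + 2 * P.HV + 8 ≤ P.Zp / 100 := by
  have hY := P.yloadG_le_eleven_G hθ hNqK
  obtain ⟨hG, hH, _, _, _⟩ := P.tinyV
  have hZ := P.Zp_ge
  have h36 : (2 : ℝ) ^ 36 = 2 ^ 32 * 16 := by norm_num
  nlinarith

/-- **`ADV E ≤ (27/100) · Zp`** for `0 ≤ E ≤ W_LV` (`MordV₀₀ ≤ 17(n+1)LgV`, `(n+1) LgV W_LV ≤ Zp/64`). [folklore] -/
theorem ADV_le {E : ℝ} (hE0 : 0 ≤ E) (hE : E ≤ P.WLV) : P.ADV E ≤ (27 / 100) * P.Zp := by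
  have hM : (P.MordV 0 0 : ℝ) ≤ 17 * (n + 1) * P.LgV := by
    have := P.MordV_zero_zero_add_le; have : (0:ℝ) ≤ n := by positivity
    linarith
  have h1 := P.WLV_mul_le
  have hLgV' : (P.LgV : ℝ) ≤ P.LV := by exact_mod_cast P.LgV_le_LV
  have hLVg := P.LV_le_g_mul_LgV
  have hG0 : 0 ≤ P.G := by linarith [P.eight_le_G]
  have hX0 : (0 : ℝ) ≤ P.XV := by positivity
  have hA : ((n : ℝ) + 1) * P.LgV * P.WLV ≤ P.Zp / 64 := by
    have hWL0 : 0 ≤ P.WLV := by linarith [P.WLV_ge_one]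
    calc ((n : ℝ) + 1) * P.LgV * P.WLV ≤ ((n : ℝ) + 1) * P.LV * P.WLV := by gcongr
      _ ≤ P.G * P.XV * P.LV / 64 := h1
      _ ≤ P.G * P.XV * (P.g * P.LgV) / 64 := by gcongr
      _ = P.Zp / 64 := by unfold Zp; ring
  unfold ADV
  calc (P.MordV 0 0 : ℝ) * E ≤ (17 * (n + 1) * P.LgV) * P.WLV := mul_le_mul hM hE hE0 (by positivity)
    _ = 17 * (((n : ℝ) + 1) * P.LgV * P.WLV) := by ring
    _ ≤ 17 * (P.Zp / 64) := by linarith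
    _ ≤ (27 / 100) * P.Zp := by have := P.Zp_facts.1; linarith

/-- `0 ≤ ADV E` for `0 ≤ E`. [folklore] -/
theorem ADV_nonneg {E : ℝ} (hE0 : 0 ≤ E) : 0 ≤ P.ADV E := by unfold ADV; positivity

/-- **`logKV 0 + ADV E + 1 ≤ (536/100) · Zp`** (under `½ ≤ θ₀`, `N_q ≤ 2ⁿK`, `0 ≤ E ≤ W_LV`). [folklore] -/
theorem logKV_zero_le (hθ : 1 / 2 ≤ P.θ₀) (hNqK : P.Nq ≤ 2 ^ n * P.K) {E : ℝ} (hE0 : 0 ≤ E) (hE : E ≤ P.WLV) :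
    P.logKV 0 + P.ADV E + 1 ≤ (536 / 100) * P.Zp := by
  have hAH := P.AHV_le
  have hAV := P.AVV_le
  have hAW := P.AWV_le
  have hl := P.lunkV_le
  have hh0 := P.htsV_le 0
  have hsm := P.smallV_le hθ hNqK
  have hAD := P.ADV_le hE0 hE
  have hG0 : (0 : ℝ) ≤ P.G := le_trans (by norm_num) P.sixteen_le_G
  have hH0 : (0 : ℝ) ≤ P.HV := by positivity
  have hZ := P.Zp_facts.1
  simp only [pow_zero, one_mul] at hh0
  unfold logKV AcoefV
  linarith

/-- `logKV ν = logKV 0 + 4 (htsV ν − htsV 0)`. [folklore] -/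
theorem logKV_eq (ν : ℕ) : P.logKV ν = P.logKV 0 + 4 * (P.htsV ν - P.htsV 0) := by unfold logKV; ring

/-! ### The masters -/

/-- **(B3′) THE k-STEP BUDGET**: `AYV + logKV ν + ADV E + 1 ≤ zerosV s ν` at every level `s` and stage `ν`.
[cite: Nesterenko2003, §4.2 (4.29)–(4.34)] -/
theorem kstep_budgetV (hθ : 1 / 2 ≤ P.θ₀) (hNqK : P.Nq ≤ 2 ^ n * P.K) (s ν : ℕ) {E : ℝ} (hE0 : 0 ≤ E)
    (hE : E ≤ P.WLV) : P.AYV + P.logKV ν + P.ADV E + 1 ≤ P.zerosV s ν := by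
  have hz := P.zerosV_ge' s ν
  have hK := P.logKV_zero_le hθ hNqK hE0 hE
  have hAY := P.AYV_le
  have hsm := P.smallV_le hθ hNqK
  have hhν := P.htsV_le ν
  have hh00 := P.htsV_nonneg 0
  have hZ := P.Zp_facts.1
  have hY := P.yloadG_pos
  have hG0 : (0 : ℝ) ≤ P.G := le_trans (by norm_num) P.sixteen_le_G
  have h2ν : (1 : ℝ) ≤ 2 ^ ν := one_le_pow₀ (by norm_num)
  rw [P.logKV_eq ν]
  have hνZ : P.Zp ≤ 2 ^ ν * P.Zp := by nlinarith
  unfold Zp at *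
  nlinarith

/-- **(B4′) THE HALF-STEP BUDGET**: `AYV + 2ⁿ · (logKV 0 + ADV E + 1) ≤ zerosV s n`.
[cite: Nesterenko2003, §4.3 (4.39)–(4.45)] -/
theorem halfstep_budgetV (hθ : 1 / 2 ≤ P.θ₀) (hNqK : P.Nq ≤ 2 ^ n * P.K) (s : ℕ) {E : ℝ} (hE0 : 0 ≤ E)
    (hE : E ≤ P.WLV) : P.AYV + 2 ^ n * (P.logKV 0 + P.ADV E + 1) ≤ P.zerosV s n := by
  have hz := P.zerosV_ge' s n
  have hK := P.logKV_zero_le hθ hNqK hE0 hE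
  have hAY := P.AYV_le
  have hsm := P.smallV_le hθ hNqK
  have hZ := P.Zp_facts.1
  have hY := P.yloadG_pos
  have hG0 : (0 : ℝ) ≤ P.G := le_trans (by norm_num) P.sixteen_le_G
  have h2n : (2 : ℝ) ≤ 2 ^ n := by
    calc (2 : ℝ) = 2 ^ 1 := by norm_num
      _ ≤ 2 ^ n := pow_le_pow_right₀ (by norm_num) P.hn
  have h2n0 : (0 : ℝ) ≤ 2 ^ n := by positivity
  have := mul_le_mul_of_nonneg_left hK h2n0
  unfold Zp at *
  nlinarith

end PadicG3Par

end Summit.ABC.StewartYu
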